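import Literature.NumberTheory.LFunctions.BurnolZetaSystems
import Literature.NumberTheory.LFunctions.BurnolHardyRightTools
import Literature.NumberTheory.LFunctions.BurnolHardyRightPaleyWiener
import Mathlib.MeasureTheory.Integral.Prod
import Mathlib.Analysis.SpecialFunctions.ImproperIntegrals
import Mathlib.Analysis.SpecialFunctions.Integrability.Basic
import Mathlib.MeasureTheory.Function.SpecialFunctions.Basic
import HarnessLib

/-!
# The tail average `t ↦ ∫_{max(t,a)}^∞ k(u) du/u` and Burnol's factor `s/(s−1)` on the Mellin side

LINE 1 — LABEL: RH-FREE (real analysis / Mellin transforms on `(0,∞)`; the Riemann zeta function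
does not occur). FRAMING (cell rh-crit, D-0074): tooling for the as-printed discharges of Burnol 2004b
§4 (the repaired Prop. 4.1 `Burnol2004b_prop4_1R` clause (ii), Prop. 4.3, Lemma 4.4). bears_on:
B-C/B-P (LADDER-RH COLUMN 6, de Branges framework) as infrastructure only. WHAT THIS IS NOT: not a
route, not a criterion; nothing here bears on the truth of RH.

Source: J.-F. Burnol, *Two complete and minimal systems associated with the zeros of the Riemann zeta
function*, J. Théor. Nombres Bordeaux 16 (2004) 65–94 = arXiv:math/0203120v7 (`Burnol2004b`), §4,
TeX of record `dbl/src/Burnol2004JTNB_arXivmath0203120v7.tex` l.638–643: "the right Mellin transform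
is an isometric identification of `ℂ·𝟙_{0<t<a} + L²(a,∞; dt)` with `(s/(s−1))A^s ℍ²`"; and
J.-F. Burnol, *On Fourier and Zeta(s)*, Forum Math. 16 (2004) (`Burnol2004`), TeX of record
`dbl/src/Burnol2004ForumMath_arXivmath0112254.tex` l.2405–2410: "Let `N` be the unitary invariant
operator which, under the right Mellin transform, has spectral function `s/(s−1)`. Explicitely:
`N(f)(t) = f(t) − ∫_t^∞ f(u) du/u`", `L_λ = N·L²((λ,∞),dt) ∩ 𝓕₊·N·L²((λ,∞),dt)`.

## What is proved (all theorems; no definition, no named fact)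

For `k ∈ L²(ℝ)` and `a > 0`, write `Pk(t) = ∫_{u > max(t,a)} k(u) du/u` (spelled out literally as
`∫ u in Ioi (max t a), k u / u`; no definition is introduced).

* `BurnolTailAvg.tailAvg_of_le` — `Pk(t) = ∫_a^∞ k(u)du/u` for `t ≤ a`: `Pk` is CONSTANT on `(0,a]`
  (so `Nk = k − Pk` is constant on `(0,a)` when `k` vanishes there: `sub_tailAvg_of_le`).
* `BurnolTailAvg.rightMellin_tailAvg_eq` — **Fubini**: for `1/2 < Re s < 1`, `P̂k(s)` converges
  absolutely and `P̂k(s) = (∫_a^∞ k(u)u^{−s}du)/(1 − s)` (`∫_0^u t^{−s}dt = u^{1−s}/(1−s)`).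
* `BurnolTailAvg.rightMellin_tailAvg`, `BurnolTailAvg.rightMellin_sub_tailAvg` — for `k` vanishing
  a.e. on `(−∞,a]`: `P̂k(s) = k̂(s)/(1−s)` and **`(k − Pk)^(s) = (s/(s−1))·k̂(s)`** on the strip
  `1/2 < Re s < 1` — the operator `N = 1 − P` has spectral function `s/(s−1)` (Forum l.2405–2410),
  which is the `t`-side of "`ℂ·𝟙_{0<t<a} + L²(a,∞) ≅ (s/(s−1))A^sℍ²`" (JTNB l.638–643).

* `BurnolTailAvg.exists_sub_tailAvg_rightMellin_eq` (UPDATE 2026-08-26, append) — **the `t`-side of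
  clause (ii) of `Burnol2004b_prop4_1R` assembled**: if `F ∈ ℍ²` and `F(s) = a^s·((s−1)/s)·G(s)` on
  `{Re s > 1/2} ∖ {1}`, then (Paley–Wiener in Mellin coordinates,
  `IsHardyRight.exists_rightMellin_eq_Ioi`) there is `φ ∈ L²` vanishing on `(−∞,a]` with
  `φ̂(s) = ((s−1)/s)·G(s)`, and `f₀ := φ − Pφ` (constant on `(0,a)`) has `f̂₀(s) = G(s)` on the strip
  `1/2 < Re s < 1` ("`F(s)` … is the Mellin transform of an element `f(t)` of
  `ℂ·𝟙_{0<t<a} + L²(a,∞;dt)`", proof of Prop. 4.1, TeX l.660–665).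

The `L²` bound for `Pk` on `(a,∞)` (Hardy's inequality, `‖Pk‖ ≤ 2‖k‖`) is NOT proved here (it is
`Literature/Analysis/FunctionSpaces/HardyInequalityTail.lean`, seat gm-t6); only absolute convergence
of the Mellin integrals on the strip is needed and proved (Cauchy–Schwarz via `MemLp.integrable_mul`).

## References

* J.-F. Burnol, JTNB 16 (2004), §4 (arXiv:math/0203120v7 p. 7, TeX l.632–643). [key `Burnol2004b`]
* J.-F. Burnol, Forum Math. 16 (2004), §6 (arXiv:math/0112254, TeX l.2405–2410). [key `Burnol2004`]
-/

noncomputable section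

open MeasureTheory Complex Filter Set Real
open scoped Topology

namespace Literature.NumberTheory.LFunctions

namespace BurnolTailAvg

variable {a : ℝ} {k : ℝ → ℂ}

/-! ### The tail average is constant on `(0, a]` -/

/-- `Pk(t) = ∫_a^∞ k(u)du/u` for `t ≤ a`: the tail average is constant on `(0,a]` ("`ℂ·𝟙_{0<t<a}`",
TeX l.638–643). [cite: Burnol2004b, §4 before Prop. 4.1 (arXiv:math/0203120v7 p. 7, TeX l.638–643)] -/
theorem tailAvg_of_le (k : ℝ → ℂ) {a t : ℝ} (ht : t ≤ a) :
    (∫ u in Ioi (max t a), k u / (u : ℂ)) = ∫ u in Ioi a, k u / (u : ℂ) := by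
  rw [max_eq_right ht]

/-- `Pk(t) = ∫_t^∞ k(u)du/u` for `t ≥ a` (Burnol's `∫_t^∞ f(u)du/u`, Forum l.2405–2410).
[cite: Burnol2004, §6 (arXiv:math/0112254, TeX l.2405–2410)] -/
theorem tailAvg_of_ge (k : ℝ → ℂ) {a t : ℝ} (ht : a ≤ t) :
    (∫ u in Ioi (max t a), k u / (u : ℂ)) = ∫ u in Ioi t, k u / (u : ℂ) := by
  rw [max_eq_left ht]

/-- `Nk = k − Pk` equals the constant `−∫_a^∞ k(u)du/u` a.e. on `(−∞, a]` when `k` vanishes a.e.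
there. [cite: Burnol2004b, §4 before Prop. 4.1 (arXiv:math/0203120v7 p. 7, TeX l.638–643)] -/
theorem sub_tailAvg_of_le (k : ℝ → ℂ) (a : ℝ) (hk0 : ∀ᵐ t : ℝ, t ≤ a → k t = 0) :
    ∀ᵐ t : ℝ, t ≤ a →
      k t - ∫ u in Ioi (max t a), k u / (u : ℂ) = -∫ u in Ioi a, k u / (u : ℂ) := by
  filter_upwards [hk0] with t ht hta
  rw [ht hta, tailAvg_of_le k hta, zero_sub]

/-! ### Absolute convergence on the strip -/

/-- `t ↦ t^z ∈ L²(a,∞)` for `Re z < −1/2`, `a > 0`. [folklore] -/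
private theorem memLp_cpow_Ioi (ha : 0 < a) {z : ℂ} (hz : z.re < -1 / 2) :
    MemLp (fun t : ℝ ↦ (t : ℂ) ^ z) 2 (volume.restrict (Ioi a)) := by
  have hc : ContinuousOn (fun t : ℝ ↦ (t : ℂ) ^ z) (Ioi a) := fun t ht ↦
    (continuousAt_ofReal_cpow_const _ _ (Or.inr (ha.trans ht).ne')).continuousWithinAt
  rw [memLp_two_iff_integrable_sq_norm (hc.aestronglyMeasurable measurableSet_Ioi)]
  have h2 : IntegrableOn (fun t : ℝ ↦ t ^ (2 * z.re)) (Ioi a) :=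
    integrableOn_Ioi_rpow_of_lt (by linarith) ha
  refine h2.congr_fun (fun t ht ↦ ?_) measurableSet_Ioi
  have ht0 : 0 < t := ha.trans ht
  rw [norm_cpow_eq_rpow_re_of_pos ht0, ← Real.rpow_natCast, ← Real.rpow_mul ht0.le]
  push_cast; ring_nf

/-- `u ↦ u^{−s}k(u)` is integrable on `(a,∞)` for `k ∈ L²(ℝ)`, `Re s > 1/2` (Cauchy–Schwarz).
[cite: Burnol2004b, §1 (arXiv:math/0203120v7 p. 4, TeX l.350–355)] -/
theorem integrableOn_cpow_mul (ha : 0 < a) (hk : MemLp k 2 (volume : Measure ℝ)) {s : ℂ}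
    (hs : 1 / 2 < s.re) : IntegrableOn (fun u : ℝ ↦ (u : ℂ) ^ (-s) * k u) (Ioi a) :=
  (memLp_cpow_Ioi ha (by simp only [neg_re]; linarith)).integrable_mul (hk.restrict _)

/-- `u ↦ k(u)/u` is integrable on `(a,∞)` for `k ∈ L²(ℝ)`, `a > 0` (so the tail average is a
genuine integral). [cite: Burnol2004, §6 (arXiv:math/0112254, TeX l.2405–2410)] -/
theorem integrableOn_div (ha : 0 < a) (hk : MemLp k 2 (volume : Measure ℝ)) :
    IntegrableOn (fun u : ℝ ↦ k u / (u : ℂ)) (Ioi a) := by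
  have h := integrableOn_cpow_mul ha hk (s := 1) (by norm_num)
  refine h.congr_fun (fun u _ ↦ ?_) measurableSet_Ioi
  dsimp only
  rw [cpow_neg_one, div_eq_mul_inv, mul_comm]

/-- For `k ∈ L²(ℝ)` vanishing a.e. on `(−∞,a]` (`a > 0`), the right Mellin integral over `(0,∞)`
is the integral over `(a,∞)`: `k̂(s) = ∫_a^∞ k(u)u^{−s}du`.
[cite: Burnol2004b, §1 (arXiv:math/0203120v7 p. 4, TeX l.350–355)] -/
theorem rightMellin_eq_setIntegral_Ioi (ha : 0 < a) (hk0 : ∀ᵐ t : ℝ, t ≤ a → k t = 0) (s : ℂ) :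
    rightMellin k s = ∫ u in Ioi a, (u : ℂ) ^ (-s) * k u := by
  have e : (1 : ℂ) - s - 1 = -s := by ring
  simp only [rightMellin, mellin, e, smul_eq_mul]
  have hI : ∫ u in Ioi (0 : ℝ), (u : ℂ) ^ (-s) * k u =
      ∫ u in Ioi (0 : ℝ), (Ioi a).indicator (fun u : ℝ ↦ (u : ℂ) ^ (-s) * k u) u := by
    refine integral_congr_ae ?_
    filter_upwards [ae_restrict_of_ae (s := Ioi (0 : ℝ)) hk0] with u hu
    by_cases hua : a < u
    · rw [indicator_of_mem (show u ∈ Ioi a from hua)]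
    · rw [indicator_of_notMem (show u ∉ Ioi a from hua), hu (not_lt.1 hua), mul_zero]
  rw [hI, setIntegral_indicator measurableSet_Ioi,
    show Ioi (0 : ℝ) ∩ Ioi a = Ioi a from by rw [inter_eq_right]; exact Ioi_subset_Ioi ha.le]

/-- Absolute convergence of `k̂(s)` on `Re s > 1/2` for `k ∈ L²(ℝ)` vanishing a.e. on `(−∞,a]`.
[cite: Burnol2004b, §1 (arXiv:math/0203120v7 p. 4, TeX l.350–355)] -/
theorem mellinConvergent_of_memLp (ha : 0 < a) (hk : MemLp k 2 (volume : Measure ℝ))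
    (hk0 : ∀ᵐ t : ℝ, t ≤ a → k t = 0) {s : ℂ} (hs : 1 / 2 < s.re) :
    MellinConvergent k (1 - s) := by
  have e : (1 : ℂ) - s - 1 = -s := by ring
  have hI := integrableOn_cpow_mul ha hk hs
  have hall : Integrable (fun u : ℝ ↦ (Ioi a).indicator (fun u : ℝ ↦ (u : ℂ) ^ (-s) * k u) u) :=
    (integrable_indicator_iff measurableSet_Ioi).2 hI
  have hall' : Integrable (fun u : ℝ ↦ (u : ℂ) ^ (-s) * k u) := by
    refine hall.congr ?_
    filter_upwards [hk0] with u hu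
    by_cases hua : a < u
    · rw [indicator_of_mem (show u ∈ Ioi a from hua)]
    · rw [indicator_of_notMem (show u ∉ Ioi a from hua), hu (not_lt.1 hua), mul_zero]
  simpa [MellinConvergent, e, smul_eq_mul] using hall'.integrableOn

/-! ### Continuity (hence measurability) of the tail average -/

/-- `Pk(t) = ∫_t^∞ g` with `g = 𝟙_{(a,∞)}·k(u)/u` (for every real `t`). [folklore] -/
private theorem tailAvg_eq_setIntegral_indicator (k : ℝ → ℂ) (a t : ℝ) :
    (∫ u in Ioi (max t a), k u / (u : ℂ)) =
      ∫ u in Ioi t, (Ioi a).indicator (fun u : ℝ ↦ k u / (u : ℂ)) u := by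
  rw [setIntegral_indicator measurableSet_Ioi, Ioi_inter_Ioi]

/-- The tail average `t ↦ ∫_{max(t,a)}^∞ k(u)du/u` of `k ∈ L²(ℝ)` (`a > 0`) is CONTINUOUS on `ℝ`
(a primitive of the integrable function `𝟙_{(a,∞)}k(u)/u`); in particular it is measurable, so that
`Nk = k − Pk` defines an `L²_{loc}` class. [cite: Burnol2004, §6 (arXiv:math/0112254, TeX l.2405–2410)] -/
theorem continuous_tailAvg (ha : 0 < a) (hk : MemLp k 2 (volume : Measure ℝ)) :
    Continuous (fun t : ℝ ↦ ∫ u in Ioi (max t a), k u / (u : ℂ)) := by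
  set g : ℝ → ℂ := (Ioi a).indicator (fun u : ℝ ↦ k u / (u : ℂ)) with hg
  have hgi : Integrable g := (integrable_indicator_iff measurableSet_Ioi).2 (integrableOn_div ha hk)
  have heq : (fun t : ℝ ↦ ∫ u in Ioi (max t a), k u / (u : ℂ)) =
      fun t : ℝ ↦ ((∫ u, g u) - ∫ u in Iic (0 : ℝ), g u) - ∫ u in (0 : ℝ)..t, g u := by
    funext t
    rw [tailAvg_eq_setIntegral_indicator, ← hg,
      ← intervalIntegral.integral_Iic_sub_Iic hgi.integrableOn hgi.integrableOn,
      ← intervalIntegral.integral_Iic_add_Ioi (b := t) hgi.integrableOn hgi.integrableOn]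
    ring
  rw [heq]
  exact continuous_const.sub
    (intervalIntegral.continuous_primitive (fun _ _ ↦ hgi.intervalIntegrable) 0)

/-- Measurability of the tail average. [cite: Burnol2004, §6 (arXiv:math/0112254, TeX l.2405–2410)] -/
theorem aestronglyMeasurable_tailAvg (ha : 0 < a) (hk : MemLp k 2 (volume : Measure ℝ))
    (μ : Measure ℝ) :
    AEStronglyMeasurable (fun t : ℝ ↦ ∫ u in Ioi (max t a), k u / (u : ℂ)) μ :=
  (continuous_tailAvg ha hk).aestronglyMeasurable

/-! ### Fubini: `P̂k(s) = (∫_a^∞ k(u)u^{−s}du)/(1−s)` -/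

/-- `∫_0^u t^{−s} dt = u^{1−s}/(1−s)` for `u > 0`, `Re s < 1` (as a set integral over `(0,u)`).
[folklore] -/
private theorem setIntegral_Ioo_cpow {u : ℝ} (hu : 0 < u) {s : ℂ} (hs : s.re < 1) :
    ∫ t in Ioo (0 : ℝ) u, (t : ℂ) ^ (-s) = (u : ℂ) ^ (1 - s) / (1 - s) := by
  have hs0 : -1 < (-s).re := by simp only [neg_re]; linarith
  have h1s : (-s : ℂ) + 1 ≠ 0 := by
    intro h
    have := congrArg Complex.re h
    simp only [add_re, neg_re, one_re, zero_re] at this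
    linarith
  rw [setIntegral_congr_set Ioo_ae_eq_Ioc, ← intervalIntegral.integral_of_le hu.le,
    integral_cpow (Or.inl hs0), ofReal_zero, zero_cpow h1s, sub_zero, neg_add_eq_sub]

/-- `∫_0^u t^{−σ} dt = u^{1−σ}/(1−σ)` for `u > 0`, `σ < 1` (real form). [folklore] -/
private theorem setIntegral_Ioo_rpow {u : ℝ} (hu : 0 < u) {σ : ℝ} (hσ : σ < 1) :
    ∫ t in Ioo (0 : ℝ) u, t ^ (-σ) = u ^ (1 - σ) / (1 - σ) := by
  have h1 : (1 : ℝ) - σ ≠ 0 := by linarith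
  rw [setIntegral_congr_set Ioo_ae_eq_Ioc, ← intervalIntegral.integral_of_le hu.le,
    integral_rpow (Or.inl (by linarith : (-1 : ℝ) < -σ)), neg_add_eq_sub,
    Real.zero_rpow h1, sub_zero]

/-- **Fubini for the tail average.** For `k ∈ L²(ℝ)`, `a > 0` and `1/2 < Re s < 1`: the right
Mellin integral of `Pk(t) = ∫_{max(t,a)}^∞ k(u)du/u` converges absolutely at `s` and
`P̂k(s) = ∫_0^∞ t^{−s} ∫_{u>max(t,a)} k(u)du/u dt = ∫_a^∞ k(u)/u ∫_0^u t^{−s}dt du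
= (∫_a^∞ k(u)u^{−s}du)/(1−s)` — the Mellin multiplier `1/(1−s)` of `∫_t^∞ · du/u`
(Forum l.2405–2410: `N = 1 − P` "has spectral function `s/(s−1)`").
[cite: Burnol2004, §6 (arXiv:math/0112254, TeX l.2405–2410)]
[cite: Burnol2004b, §4 before Prop. 4.1 (arXiv:math/0203120v7 p. 7, TeX l.638–643)] -/
theorem rightMellin_tailAvg_eq (ha : 0 < a) (hk : MemLp k 2 (volume : Measure ℝ)) {s : ℂ}
    (hs1 : 1 / 2 < s.re) (hs2 : s.re < 1) :
    MellinConvergent (fun t : ℝ ↦ ∫ u in Ioi (max t a), k u / (u : ℂ)) (1 - s) ∧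
      rightMellin (fun t : ℝ ↦ ∫ u in Ioi (max t a), k u / (u : ℂ)) s =
        (∫ u in Ioi a, (u : ℂ) ^ (-s) * k u) / (1 - s) := by
  set μ : Measure ℝ := volume.restrict (Ioi (0 : ℝ)) with hμ
  set ν : Measure ℝ := volume.restrict (Ioi a) with hν
  have hs0 : -1 < (-s).re := by simp only [neg_re]; linarith
  have h1σ : (1 : ℝ) - s.re ≠ 0 := by linarith
  have h1s : (1 : ℂ) - s ≠ 0 := by
    intro h
    have := congrArg Complex.re h
    simp only [sub_re, one_re, zero_re] at this
    linarith
  have e : (1 : ℂ) - s - 1 = -s := by ring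
  -- the integrand on `(0,∞) × (a,∞)`
  set G : ℝ × ℝ → ℂ :=
    {p : ℝ × ℝ | p.1 < p.2}.indicator (fun p ↦ (p.1 : ℂ) ^ (-s) * (k p.2 / (p.2 : ℂ))) with hG
  have hGt : ∀ t : ℝ, (fun u : ℝ ↦ G (t, u)) =
      (Ioi t).indicator (fun u : ℝ ↦ (t : ℂ) ^ (-s) * (k u / (u : ℂ))) := by
    intro t; funext u
    simp only [hG, Set.indicator_apply, mem_setOf_eq, mem_Ioi]
  have hGu : ∀ u : ℝ, (fun t : ℝ ↦ G (t, u)) =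
      (Iio u).indicator (fun t : ℝ ↦ (t : ℂ) ^ (-s) * (k u / (u : ℂ))) := by
    intro u; funext t
    simp only [hG, Set.indicator_apply, mem_setOf_eq, mem_Iio]
  -- measurability
  have hGm : AEStronglyMeasurable G (μ.prod ν) := by
    have h1 : AEStronglyMeasurable (fun p : ℝ × ℝ ↦ (p.1 : ℂ) ^ (-s)) (μ.prod ν) :=
      ((Complex.measurable_ofReal.comp measurable_fst).pow_const _).aestronglyMeasurable
    have h2 : AEStronglyMeasurable (fun p : ℝ × ℝ ↦ k p.2 / (p.2 : ℂ)) (μ.prod ν) := by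
      have hk2 : AEStronglyMeasurable (fun p : ℝ × ℝ ↦ k p.2) (μ.prod ν) :=
        (hk.1.restrict (s := Ioi a)).comp_snd
      have hi : AEStronglyMeasurable (fun p : ℝ × ℝ ↦ ((p.2 : ℝ) : ℂ)⁻¹) (μ.prod ν) :=
        (Complex.measurable_ofReal.comp measurable_snd).inv.aestronglyMeasurable
      simpa [div_eq_mul_inv, Pi.mul_def] using hk2.mul hi
    exact (h1.mul h2).indicator (measurableSet_lt measurable_fst measurable_snd)
  -- the `t`-slices are integrable and their norm integrals are `u^{1-σ}/(1-σ) · ‖k u/u‖`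
  have hslice : ∀ u : ℝ, 0 < u → Integrable (fun t : ℝ ↦ G (t, u)) μ := by
    intro u hu
    rw [hGu u, integrable_indicator_iff measurableSet_Iio, IntegrableOn, hμ,
      Measure.restrict_restrict measurableSet_Iio, Iio_inter_Ioi]
    exact ((intervalIntegral.integrableOn_Ioo_cpow_iff hu).2 hs0).mul_const _
  have hnorm : ∀ u : ℝ, 0 < u → ∫ t, ‖G (t, u)‖ ∂μ =
      u ^ (1 - s.re) / (1 - s.re) * ‖k u / (u : ℂ)‖ := by
    intro u hu
    have h1 : (fun t : ℝ ↦ ‖G (t, u)‖) =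
        (Iio u).indicator (fun t : ℝ ↦ ‖(t : ℂ) ^ (-s) * (k u / (u : ℂ))‖) := by
      funext t
      have ht : G (t, u) = (Iio u).indicator (fun t : ℝ ↦ (t : ℂ) ^ (-s) * (k u / (u : ℂ))) t :=
        congrFun (hGu u) t
      rw [ht, norm_indicator_eq_indicator_norm]
    rw [h1, integral_indicator measurableSet_Iio, hμ, Measure.restrict_restrict measurableSet_Iio,
      Iio_inter_Ioi]
    have h2 : ∫ t in Ioo 0 u, ‖(t : ℂ) ^ (-s) * (k u / (u : ℂ))‖ =
        ∫ t in Ioo 0 u, t ^ (-s.re) * ‖k u / (u : ℂ)‖ := by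
      refine setIntegral_congr_fun measurableSet_Ioo (fun t ht ↦ ?_)
      rw [norm_mul, norm_cpow_eq_rpow_re_of_pos ht.1, neg_re]
    rw [h2, integral_mul_const, setIntegral_Ioo_rpow hu hs2]
  -- integrability on the product
  have hGi : Integrable G (μ.prod ν) := by
    rw [integrable_prod_iff' hGm]
    refine ⟨?_, ?_⟩
    · filter_upwards [ae_restrict_mem measurableSet_Ioi] with u hu
      exact hslice u (ha.trans hu)
    · have hI := (integrableOn_cpow_mul ha hk hs1).norm.const_mul (1 / (1 - s.re))
      refine (hI.congr ?_)
      filter_upwards [ae_restrict_mem measurableSet_Ioi] with u hu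
      have hu0 : 0 < u := ha.trans hu
      rw [hnorm u hu0, norm_mul, norm_div, norm_cpow_eq_rpow_re_of_pos hu0, neg_re,
        Complex.norm_of_nonneg hu0.le, Real.rpow_neg hu0.le,
        show (1 : ℝ) - s.re = -s.re + 1 by ring, Real.rpow_add hu0, Real.rpow_neg hu0.le,
        Real.rpow_one]
      field_simp
  -- Fubini
  have hswap : ∫ t, ∫ u, G (t, u) ∂ν ∂μ = ∫ u, ∫ t, G (t, u) ∂μ ∂ν :=
    integral_integral_swap (f := fun t u ↦ G (t, u)) hGi
  -- inner integral in `u`: `t^{-s} · Pk(t)`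
  have hinner_u : ∀ t : ℝ, ∫ u, G (t, u) ∂ν =
      (t : ℂ) ^ (-s) * ∫ u in Ioi (max t a), k u / (u : ℂ) := by
    intro t
    rw [hGt t, integral_indicator measurableSet_Ioi, hν, Measure.restrict_restrict measurableSet_Ioi,
      Ioi_inter_Ioi, integral_const_mul]
  -- inner integral in `t`: `u^{-s} k(u)/(1-s)`
  have hinner_t : ∀ u : ℝ, 0 < u → ∫ t, G (t, u) ∂μ = (u : ℂ) ^ (-s) * k u / (1 - s) := by
    intro u hu
    have hu0 : (u : ℂ) ≠ 0 := ofReal_ne_zero.2 hu.ne'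
    rw [hGu u, integral_indicator measurableSet_Iio, hμ, Measure.restrict_restrict measurableSet_Iio,
      Iio_inter_Ioi, integral_mul_const, setIntegral_Ioo_cpow hu hs2,
      show (1 : ℂ) - s = 1 + -s by ring, cpow_add _ _ hu0, cpow_one]
    field_simp
  -- assemble
  have hmel : (fun t : ℝ ↦ (t : ℂ) ^ (1 - s - 1) • ∫ u in Ioi (max t a), k u / (u : ℂ)) =
      fun t : ℝ ↦ ∫ u, G (t, u) ∂ν := by
    funext t; rw [hinner_u t, e, smul_eq_mul]
  refine ⟨?_, ?_⟩
  · -- absolute convergence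
    have h := hGi.integral_prod_left
    rw [MellinConvergent, IntegrableOn, ← hμ, hmel]
    exact h
  · rw [rightMellin, mellin, ← hμ, hmel, hswap, ← integral_div]
    refine integral_congr_ae ?_
    filter_upwards [ae_restrict_mem measurableSet_Ioi] with u hu
    exact hinner_t u (ha.trans hu)

/-- **`P̂k(s) = k̂(s)/(1−s)`** on `1/2 < Re s < 1` for `k ∈ L²(ℝ)` vanishing a.e. on `(−∞,a]`.
[cite: Burnol2004, §6 (arXiv:math/0112254, TeX l.2405–2410)]
[cite: Burnol2004b, §4 before Prop. 4.1 (arXiv:math/0203120v7 p. 7, TeX l.638–643)] -/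
theorem rightMellin_tailAvg (ha : 0 < a) (hk : MemLp k 2 (volume : Measure ℝ))
    (hk0 : ∀ᵐ t : ℝ, t ≤ a → k t = 0) {s : ℂ} (hs1 : 1 / 2 < s.re) (hs2 : s.re < 1) :
    rightMellin (fun t : ℝ ↦ ∫ u in Ioi (max t a), k u / (u : ℂ)) s = rightMellin k s / (1 - s) := by
  rw [(rightMellin_tailAvg_eq ha hk hs1 hs2).2, rightMellin_eq_setIntegral_Ioi ha hk0 s]

/-- Absolute convergence of `P̂k(s)` on the strip `1/2 < Re s < 1` (`k ∈ L²(ℝ)`, `a > 0`).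
[cite: Burnol2004, §6 (arXiv:math/0112254, TeX l.2405–2410)] -/
theorem mellinConvergent_tailAvg (ha : 0 < a) (hk : MemLp k 2 (volume : Measure ℝ)) {s : ℂ}
    (hs1 : 1 / 2 < s.re) (hs2 : s.re < 1) :
    MellinConvergent (fun t : ℝ ↦ ∫ u in Ioi (max t a), k u / (u : ℂ)) (1 - s) :=
  (rightMellin_tailAvg_eq ha hk hs1 hs2).1

/-- **Burnol's operator `N = 1 − P` has spectral function `s/(s−1)`**: for `k ∈ L²(ℝ)` vanishing
a.e. on `(−∞,a]` (`a > 0`) and `1/2 < Re s < 1`,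
`(k − Pk)^(s) = k̂(s) − k̂(s)/(1−s) = (s/(s−1))·k̂(s)`, where `Pk(t) = ∫_{max(t,a)}^∞ k(u)du/u`.
Together with `sub_tailAvg_of_le` (`k − Pk` is constant on `(0,a)`) this is the `t`-side of the
identification `ℂ·𝟙_{0<t<a} + L²(a,∞; dt) ≅ (s/(s−1))A^sℍ²` (the `L²` bound on `Pk` being Hardy's
inequality). [cite: Burnol2004, §6 (arXiv:math/0112254, TeX l.2405–2410)]
[cite: Burnol2004b, §4 before Prop. 4.1 (arXiv:math/0203120v7 p. 7, TeX l.638–643)] -/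
theorem rightMellin_sub_tailAvg (ha : 0 < a) (hk : MemLp k 2 (volume : Measure ℝ))
    (hk0 : ∀ᵐ t : ℝ, t ≤ a → k t = 0) {s : ℂ} (hs1 : 1 / 2 < s.re) (hs2 : s.re < 1) :
    rightMellin (fun t : ℝ ↦ k t - ∫ u in Ioi (max t a), k u / (u : ℂ)) s =
      s / (s - 1) * rightMellin k s := by
  have h1s : (1 : ℂ) - s ≠ 0 := by
    intro h
    have := congrArg Complex.re h
    simp only [sub_re, one_re, zero_re] at this
    linarith
  have hs1' : s - 1 ≠ 0 := by
    intro h; apply h1s; rw [sub_eq_zero] at h; rw [h, sub_self]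
  have hK := mellinConvergent_of_memLp ha hk hk0 hs1
  have hP := mellinConvergent_tailAvg ha hk hs1 hs2
  have hsub : rightMellin (fun t : ℝ ↦ k t - ∫ u in Ioi (max t a), k u / (u : ℂ)) s =
      rightMellin k s - rightMellin (fun t : ℝ ↦ ∫ u in Ioi (max t a), k u / (u : ℂ)) s := by
    simp only [rightMellin, mellin]
    rw [← integral_sub hK hP]
    refine integral_congr_ae (Eventually.of_forall fun t ↦ ?_)
    simp only [smul_eq_mul, mul_sub]
  rw [hsub, rightMellin_tailAvg ha hk hk0 hs1 hs2]
  field_simp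
  ring

/-! ### The `t`-side of Prop. 4.1 (ii): a preimage in `ℂ·𝟙_{(0,a)} + L²(a,∞)` -/

/-- **From `(s/(s−1))A^sℍ²` back to `ℂ·𝟙_{0<t<a} + L²(a,∞; dt)`** (proof of Prop. 4.1: "If a
function `F(s)` belongs to `(s/(s−1))A^sℍ²` … it is square-integrable and is the Mellin transform of
an element `f(t)` of `ℂ·𝟙_{0<t<a} + L²(a,∞;dt)`", TeX l.660–665). Precisely: if `F ∈ ℍ²(Re s > 1/2)`
and `F(s) = a^s·((s−1)/s)·G(s)` on the punctured half-plane, then there is a measurable `φ ∈ L²(ℝ)`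
vanishing on `(−∞, a]` with `φ̂(s) = ((s−1)/s)·G(s)` on `{Re s > 1/2} ∖ {1}` (Paley–Wiener in Mellin
coordinates), and the function `f₀ = φ − Pφ`, `Pφ(t) = ∫_{max(t,a)}^∞ φ(u)du/u` — which is the
constant `−∫_a^∞ φ(u)du/u` on `(−∞,a]` (`sub_tailAvg_of_le`) — satisfies `f̂₀(s) = G(s)` on the strip
`1/2 < Re s < 1` (`rightMellin_sub_tailAvg`). (That `Pφ ∈ L²(a,∞)` is Hardy's inequality, not used
here.) [cite: Burnol2004b, Prop. 4.1, proof (arXiv:math/0203120v7 p. 7, TeX l.656–669)] -/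
theorem exists_sub_tailAvg_rightMellin_eq (ha : 0 < a) {F G : ℂ → ℂ} (hF : IsHardyRight F)
    (hFG : ∀ s : ℂ, 1 / 2 < s.re → s ≠ 1 → F s = (a : ℂ) ^ s * ((s - 1) / s) * G s) :
    ∃ φ : ℝ → ℂ, Measurable φ ∧ (∀ t : ℝ, t ≤ a → φ t = 0) ∧ MemLp φ 2 volume ∧
      (∀ s : ℂ, 1 / 2 < s.re → s ≠ 1 → rightMellin φ s = (s - 1) / s * G s) ∧
      ∀ s : ℂ, 1 / 2 < s.re → s.re < 1 →
        MellinConvergent (fun t : ℝ ↦ ∫ u in Ioi (max t a), φ u / (u : ℂ)) (1 - s) ∧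
        rightMellin (fun t : ℝ ↦ φ t - ∫ u in Ioi (max t a), φ u / (u : ℂ)) s = G s := by
  have ha0 : (a : ℂ) ≠ 0 := ofReal_ne_zero.2 ha.ne'
  -- `K(s) = a^{-s} F(s)`, so that `a^s K(s) = F(s)` on the whole half-plane
  set K : ℂ → ℂ := fun s ↦ (a : ℂ) ^ (-s) * F s with hKdef
  have hK : IsHardyRight (fun s ↦ (a : ℂ) ^ s * K s) := by
    refine hF.congr (fun s _ ↦ ?_)
    simp only [hKdef]
    rw [← mul_assoc, ← cpow_add _ _ ha0, add_neg_cancel, cpow_zero, one_mul]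
  obtain ⟨φ, hφm, hφ0, hφ2, hφK⟩ := IsHardyRight.exists_rightMellin_eq_Ioi ha hK
  have hφ0' : ∀ᵐ t : ℝ, t ≤ a → φ t = 0 := Eventually.of_forall hφ0
  have hne0 : ∀ s : ℂ, 1 / 2 < s.re → s ≠ 0 := by
    intro s hs h
    rw [h, Complex.zero_re] at hs
    linarith
  -- `φ̂(s) = K(s) = ((s-1)/s) G(s)` off `s = 1`
  have hφG : ∀ s : ℂ, 1 / 2 < s.re → s ≠ 1 → rightMellin φ s = (s - 1) / s * G s := by
    intro s hs hs1
    rw [(hφK s hs).2, hKdef]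
    simp only
    rw [hFG s hs hs1, ← mul_assoc, ← mul_assoc, ← cpow_add _ _ ha0, neg_add_cancel, cpow_zero,
      one_mul]
  refine ⟨φ, hφm, hφ0, hφ2, hφG, fun s hs1 hs2 ↦ ⟨mellinConvergent_tailAvg ha hφ2 hs1 hs2, ?_⟩⟩
  have hs1' : s ≠ 1 := by
    intro h
    rw [h, one_re] at hs2
    exact lt_irrefl _ hs2
  have hsub1 : s - 1 ≠ 0 := sub_ne_zero.2 hs1'
  rw [rightMellin_sub_tailAvg ha hφ2 hφ0' hs1 hs2, hφG s hs1 hs1']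
  field_simp [hne0 s hs1]

end BurnolTailAvg

end Literature.NumberTheory.LFunctions
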